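import Literature.AnabelianGeometry.EtaleTheta.Discharge.Sec2BiThetaAutCriterion
import Literature.AnabelianGeometry.EtaleTheta.Discharge.Sec2Prop214iiiBiUpperCore

/-!
# [EtTh] Prop 2.14 (iii), BI-theta case, the UPPER bound `Im_N ⊆ (N†·l·ℤ) ⋊ {±1}` AT THE §1 MODEL
# (translation part; proof-only companion)

Mochizuki, *The Étale Theta Function and its Frobenioid-theoretic Manifestations* [EtTh], Publ. RIMS 45
(2009), §2, Prop 2.14 (iii) pp.49–51 over §1 Prop 1.5 p.23 (locators `p.N` = PDF pages of the PRIMS text;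
bib key `MochizukiEtTh2009`). PROOF-ONLY companion (no `def`; seat abc-iut-L2-t2, §2 owner, row
«P214iii-BI-UPPER») of `ThetaRigidity.lean` (`RigidData.Prop214_iii_bi`, upper clause "`Ndag * l ∣ s`") at
abc-iut-L2-t8's §1 instantiation `C.rigidData` (`RigidOfSetting.lean`), continuing this seat's
`Discharge/Sec2BiThetaAutCriterion.lean` (g5: the cocycle criterion `exists_coboundary_of_biIso_over`),
`Discharge/Sec2Prop214iiiTranslationsOfModel.lean` (g3: the LOWER bound, translations by `N·(l·ℤ)` lift) and
`Discharge/Sec2Prop214iiiBiInversionOfModel.lean` (g5: the `{±1}`-factor lifts).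

PRINT (p.50–51): "the resulting homomorphism … `Aut(B) → (l·ℤ) ⋊ {±1}` … has image `Im_N` satisfying
`(N·l·ℤ) ⋊ {±1} ⊆ Im_N ⊆ (N†·l·ℤ) ⋊ {±1} ⊆ ℤ ⋊ {±1}` — where `N† = N` if `N` is odd, `N† = N/2` if `N` is
even" … "the fact that `Im_N ⊆ (N†·l·ℤ) ⋊ {±1}` follows immediately by considering, in light of the cohomology
computation of Proposition 1.5, (i), the third displayed formula of Proposition 1.4, (ii), applied to the 'mod `N`
étale theta function', which implies [cf. the computation applied in the proof of assertion (ii)] that for any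
`a·l ∈ Im_N` [where `a ∈ ℤ`], we have `2a ≡ 0 (mod N)`."

PROVED here (part 2 of 2; part 1 = `Sec2Prop214iiiBiUpperCore.lean`: the envelope-free arithmetic core
`dvd_two_mul_zExp_of_red_conj_eq` and `conj_etaDd_div_eq_infl_logUdd`), for `R = C.rigidData μ hC hS h15 L` and
EVERY mod-`N` theta cocycle `η` of `X̲̲`:

* **`dvd_two_mul_zExp_of_biIso_over_conj`** — if an automorphism `α` of the model bi-theta environment `B_N(η)`
  induces on `Π^tp_Y̲̲` the translation `y ↦ x y x⁻¹` by `x ∈ Π^tp_X̲̲` with image `a·l` in `Z` (`a = zExp x ∈ ℤ ≅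
  Gal(Y̲̲/X̲̲)`), then `N ∣ 2a`; `…_of_induces_conj` = the same in the `RigidData.Induces` currency of the typed
  statement; `…_tower` at every level of a `CyclotomeTower`; `ndag_mul_dvd_toZ_of_biIso_over_conj` = the
  `N†` form "`N†·l ∣ toZ(x)`" under the `N`-free binder "`log(Ü)` maps `Δ^tp_Ÿ̲̲` onto `Δ_Θ`".

THE ARGUMENT (print's "computation applied in the proof of (ii)", made kernel-explicit). By the criterion, `α`
acts on `μ_N = Ker(Π^tp_Y̲̲[μ_N] ↠ Π^tp_Y̲̲)` by some `ψ` with `ψ ∘ η = (η ∘ conj_x) · ∂m` on `Π^tp_Ÿ̲̲`; on the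
inverse image of `l·Δ_Θ` the cocycle `η` IS the identification `(l·Δ_Θ) ↠ μ_N` (`cocycle_lDeltaTheta`), which is
`Π^tp_X̲̲`-equivariant (`thetaMod_conj`), so `ψ = χ(aug x)` and `red ∘ f` (`η = red ∘ f`, `f` a cocycle of
`η̲̈^{Θ,l·ℤ×μ₂}`) is EXACTLY `x`-invariant on `Δ^tp_Ÿ̲̲`, where coboundaries vanish. Writing `f = (σ·F)|·∂b` with
`F` a cocycle of `η̈^Θ` (Def 2.7: the collection is the `Π^tp_X̲̲`-orbit), the quotient `(σ·F)/(xσ·F)` has class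
`infl(2al·log(Ü) + log(w))` by Prop 1.5 (iii) ("`η̈^Θ ↦ η̈^Θ − 2a·log(Ü) − (a²/2)·log(q_X) + log(O^×_K̈)`": the
factor `l` of "`l·ℤ`" and the `1/l` of the `l`-th root, p.50), and Kummer classes (`F̈²`, Prop 1.5 (ii)) vanish
pointwise on `Δ^tp_Ÿ` — so `log(Ü)(ḡ)^{2al} ∈ N·(l·Δ_Θ)` for every `g ∈ Δ^tp_Ÿ̲̲`, i.e. `red(l·log(Ü)(ḡ))^{2a} = 1`;
since `red ∘ (l·log(Ü))` maps `Δ^tp_Ÿ̲̲` ONTO `μ_N ≅ ℤ/Nℤ` (binder `hU`), `N ∣ 2a`.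

BINDERS (named, taken BY NAME; nothing smuggled): `Prop15iii` (abc-iut-L2-t1; inside `rigidData` and for the
`Z`-action formula), `Prop15ii` (`F̈² = ` the Kummer classes), and `hU` : "`red ∘ (l·log(Ü))` maps `Δ^tp_Ÿ̲̲` onto
`μ_N`" — the mod-`N` content of print's "`F̈¹/F̈² = Hom((Δ^tp_Ÿ)^ell/Δ_Θ, Δ_Θ) = Ẑ·log(Ü)`" (Prop 1.5 (ii): `log(Ü)`
is an ISOMORPHISM `(Δ^tp_Ÿ)^Θ/Δ_Θ ≅ Δ_Θ`) transported to `Ÿ̲̲` ("`Δ_X̲̲ = Im(s_ι)` maps isomorphically onto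
`Δ̄^ell_X`", Prop 2.2 (ii)), which the typed `Prop15ii` does NOT carry (its READING NOTES: the "`= Ẑ·log`"
identifications are not typed); `red_pow_logUdd_surjective_of_logUdd_surjective` derives it from the `N`-free form
"`log(Ü)` maps `Δ^tp_Ÿ̲̲` onto `Δ_Θ`". The cusp labels `L` play no role (the conclusion is about `toZ(x)`, the
group-theoretic translation part; the LABEL clause `ActsOnCuspsBy` of the typed statement stays interface input).

READING NOTE (recorded, not adjudicated). The two-sided inclusion is printed for THE model `B` built from "any
member" of the collection of cocycles (p.46). For the translation subgroup the statement is member-independent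
(this file + g3: `Im_N ∩ (l·ℤ) = N†·l·ℤ` exactly as far as typed). The `ε = −1` coset is not: transporting the
lift of the inversion along `conjX σ : B(η₀) ≃ B(σ·η₀)` (this seat's `exists_biIso_conjX_of_conj_eq`) conjugates
its cusp action `(0, −1)` into `(2·zExp(σ)·l, −1)`, so "`Im_N ⊆ (N†·l·ℤ) ⋊ {±1}`" for the `ε = −1` coset holds
for the members centred compatibly with the labels (`N† ∣ 2·zExp σ`) — consistent with g5's
`rigidData_exists_biIso_over_conjInversion` (the `σ` there depends on `η`). HONEST FRAMING: [EtTh] is refereed;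
these are OUR kernel checks at the cell's §1 model, conditional on the named §1 facts; no side is taken on
[IUTchIII] Cor 3.12; typed ≠ discharged elsewhere.
-/

noncomputable section

namespace Literature.AnabelianGeometry.EtaleTheta

open Literature.AnabelianGeometry.SemiGraphs
open scoped IsMulCommutative

namespace ThetaSetting

variable {p : ℕ} [Fact p.Prime] {D : ThetaSetting p}

namespace EtaleThetaData.DoubleUnderline

variable {E : D.EtaleThetaData} {l : ℕ} (C : E.DoubleUnderline l) {N : ℕ+} (μ : D.CyclotomeMod l N)

/-- **[EtTh] Prop 2.14 (iii), BI-theta case, UPPER bound AT THE §1 MODEL (translation part).** For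
`R = C.rigidData μ hC hS h15 L` and ANY mod-`N` theta cocycle `η` of `X̲̲`: if an automorphism `α` of the model
bi-theta environment `B_N(η)` induces on `Π^tp_Y̲̲` the translation `y ↦ x y x⁻¹` by `x ∈ Π^tp_X̲̲` — image `a·l` in
`Z`, i.e. `a ∈ ℤ ≅ Gal(Y̲̲/X̲̲)` — then `N ∣ 2a` ("for any `a·l ∈ Im_N` [where `a ∈ ℤ`], we have
`2a ≡ 0 (mod N)`", p.51; equivalently `a ∈ N†·ℤ`). PROOF (print: "follows immediately by considering, in light
of the cohomology computation of Proposition 1.5, (i), the third displayed formula of Proposition 1.4, (ii),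
applied to the 'mod `N` étale theta function'"): by the cocycle criterion `exists_coboundary_of_biIso_over`
(this seat, g5) `α` acts on `μ_N` by some `ψ` with `ψ ∘ η = (η ∘ conj_x) · ∂m`; evaluating on `l·Δ_Θ`, where
`η` IS the cyclotomic identification (`cocycle_lDeltaTheta`, `thetaMod_conj`), gives `ψ = χ(aug x)`, so `red ∘ f`
is exactly `x`-invariant on the geometric part `Δ^tp_Ÿ̲̲` (coboundaries die there), and
`dvd_two_mul_zExp_of_red_conj_eq` applies. Binders BY NAME: `Prop15iii` (inside `rigidData` and for the
`Z`-action formula), `Prop15ii` (`F̈² = ` Kummer classes), and `hU` ("`red ∘ (l·log(Ü))` maps `Δ^tp_Ÿ̲̲` onto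
`μ_N`", the mod-`N` content of "`F̈¹/F̈² = Ẑ·log(Ü)`", Prop 1.5 (ii), not carried by the typed `Prop15ii`).
[cite: MochizukiEtTh2009, Prop 2.14(iii) p.50] -/
theorem dvd_two_mul_zExp_of_biIso_over_conj (hC : D.Compat) (hS : D.Sec2Hyps) (h15 : Prop15iii E hC)
    (h15ii : Prop15ii E.toKummerData hC) (L : C.CuspLabels)
    (hU : ∃ c : contCocycles (MonoidHom.id D.GtpTheta) D.DeltaTheta (D.GtpYdd.map D.toTheta),
      (QuotientGroup.mk c : D.H1Theta (D.GtpYdd.map D.toTheta)) = E.logUdd ∧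
      ∀ m : MuN p N, ∃ (g : C.GtpYdduu) (_ : (g : D.PiTemp) ∈ D.DeltaTemp),
        μ.red ⟨((c.1 ⟨D.toTheta g, ⟨g, (Subgroup.mem_inf.1 g.2).1, rfl⟩⟩ ^ l : D.DeltaTheta) : D.GtpTheta),
          coe_pow_mem_lDeltaTheta l _⟩ = m)
    {η : D.GtpYdd.subgroupOf C.Huu → MuN p N} (hη : η ∈ C.thetaCocycles hC μ) (x : C.Huu)
    (α : ((C.rigidData μ hC hS h15 L).modelBi hη).Iso ((C.rigidData μ hC hS h15 L).modelBi hη))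
    (hα : ∀ z, ((CycEnvelope.proj (C.rigidData μ hC hS h15 L).augY (C.rigidData μ hC hS h15 L).chi (α.e z) :
          (C.rigidData μ hC hS h15 L).PiY) : C.Huu) =
        x * ((CycEnvelope.proj (C.rigidData μ hC hS h15 L).augY (C.rigidData μ hC hS h15 L).chi z :
          (C.rigidData μ hC hS h15 L).PiY) : C.Huu) * x⁻¹) :
    (N : ℤ) ∣ 2 * C.zExp x := by
  obtain ⟨f, hf, rfl⟩ := hη
  set R := C.rigidData μ hC hS h15 L with hR
  -- the cocycle criterion: `α` acts on `μ_N` by `ψ`, and `ψ ∘ η = (η ∘ conj_x) · ∂m`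
  obtain ⟨ψ, m, -, hηm⟩ :=
    R.toThetaEnvData.exists_coboundary_of_biIso_over ⟨f, hf, rfl⟩ α (fun y => x * y * x⁻¹) hα
  -- (A) `ψ = χ(aug x)`: evaluate on the inverse image of `l·Δ_Θ`, where `η = thetaMod`
  have hψ : ∀ u : MuN p N, ψ u = galMuN p N (D.aug.toMonoidHom (x : D.PiTemp)) u := by
    intro u
    obtain ⟨g, rfl⟩ := R.thetaMod_surjective u
    have hgY : (g : C.Huu) ∈ R.PiYdd ⊓ R.aug.ker := R.lDeltaTheta_le g.2
    set d : R.PiYdd := ⟨g, (Subgroup.mem_inf.1 hgY).1⟩ with hd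
    set d' : R.PiYdd := ⟨x * (g : C.Huu) * x⁻¹, R.PiYdd_normal.conj_mem _ (Subgroup.mem_inf.1 hgY).1 x⟩
      with hd'
    have h1 := hηm d d' rfl
    have hηd : C.modN μ f hf.1 d = R.thetaMod g := R.cocycle_lDeltaTheta _ ⟨f, hf, rfl⟩ d g.2
    have hηd' : C.modN μ f hf.1 d' = R.chi (R.aug x) (R.thetaMod g) := by
      rw [← R.thetaMod_conj x g]
      exact R.cocycle_lDeltaTheta _ ⟨f, hf, rfl⟩ d' (R.lDeltaTheta_normal.conj_mem _ g.2 x)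
    have haug' : R.aug (d' : R.PiX) = 1 := by
      have hg1 : R.aug (g : C.Huu) = 1 := (Subgroup.mem_inf.1 hgY).2
      change R.aug (x * (g : C.Huu) * x⁻¹) = 1
      rw [map_mul, map_mul, hg1, mul_one, ← map_mul, mul_inv_cancel, map_one]
    have hcob : CycEnvelope.coboundary (R.aug.comp R.PiYdd.subtype) R.chi m d' = 1 := by
      change m * (R.chi (R.aug (d' : R.PiX)) m)⁻¹ = 1
      rw [haug', map_one, MulAut.one_apply, mul_inv_cancel]
    rw [hηd, hηd', hcob, mul_one] at h1
    exact h1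
  -- (B) exact `x`-invariance of `red ∘ f` on the geometric part `Δ^tp_Ÿ̲̲`
  have hinv : ∀ (g : C.GtpYdduu), (g : D.PiTemp) ∈ D.DeltaTemp →
      μ.red ⟨D.toTheta (x : D.PiTemp) *
          (f.1 ⟨(x : D.PiTemp)⁻¹ * g * x, C.inv_mul_mul_mem_GtpYdduu hC x g⟩ : D.GtpTheta) *
          (D.toTheta (x : D.PiTemp))⁻¹, (D.lDeltaTheta_normal l).conj_mem _ (hf.1 _) _⟩ =
        μ.red ⟨f.1 g, hf.1 g⟩ := by
    intro g hgΔ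
    have haug : D.aug.toMonoidHom (g : D.PiTemp) = 1 := hgΔ
    set d : R.PiYdd := ⟨⟨(x : D.PiTemp)⁻¹ * g * x, (Subgroup.mem_inf.1 (C.inv_mul_mul_mem_GtpYdduu hC x g)).2⟩,
      (Subgroup.mem_inf.1 (C.inv_mul_mul_mem_GtpYdduu hC x g)).1⟩ with hd
    set d' : R.PiYdd := ⟨⟨(g : D.PiTemp), (Subgroup.mem_inf.1 g.2).2⟩, (Subgroup.mem_inf.1 g.2).1⟩ with hd'
    have hdd' : (fun y : C.Huu => x * y * x⁻¹) (d : R.PiX) = (d' : R.PiX) := by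
      apply Subtype.ext
      change (x : D.PiTemp) * ((x : D.PiTemp)⁻¹ * g * x) * (x : D.PiTemp)⁻¹ = g
      group
    have h1 := hηm d d' hdd'
    have haug' : R.aug (d' : R.PiX) = 1 := Subtype.ext haug
    have hcob : CycEnvelope.coboundary (R.aug.comp R.PiYdd.subtype) R.chi m d' = 1 := by
      change m * (R.chi (R.aug (d' : R.PiX)) m)⁻¹ = 1
      rw [haug', map_one, MulAut.one_apply, mul_inv_cancel]
    rw [hcob, mul_one, hψ] at h1
    -- `h1 : galMuN (aug x) (red (f (x⁻¹ g x))) = red (f g)`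
    have e1 : μ.red ⟨D.toTheta (x : D.PiTemp) *
          (f.1 ⟨(x : D.PiTemp)⁻¹ * g * x, C.inv_mul_mul_mem_GtpYdduu hC x g⟩ : D.GtpTheta) *
          (D.toTheta (x : D.PiTemp))⁻¹, (D.lDeltaTheta_normal l).conj_mem _ (hf.1 _) _⟩ =
        galMuN p N (D.aug.toMonoidHom (x : D.PiTemp))
          (μ.red ⟨(f.1 ⟨(x : D.PiTemp)⁻¹ * g * x, C.inv_mul_mul_mem_GtpYdduu hC x g⟩ : D.GtpTheta),
            hf.1 _⟩) :=
      μ.red_conj (x : D.PiTemp) ⟨_, hf.1 _⟩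
    rw [e1]
    exact h1
  exact C.dvd_two_mul_zExp_of_red_conj_eq μ hC h15 h15ii hf x hinv hU

/-- **The same in the `Induces` currency of `RigidData.Prop214_iii_bi`**: if `α ∈ Aut(B_N(η))` induces
`a : Π^tp_Y̲̲ ≃ₜ* Π^tp_Y̲̲` (`R.Induces α a`) and `a` is conjugation by `x ∈ Π^tp_X̲̲`, then `N ∣ 2a` for the image
`a·l` of `x` in `Z`. [cite: MochizukiEtTh2009, Prop 2.14(iii) p.50] -/
theorem dvd_two_mul_zExp_of_induces_conj (hC : D.Compat) (hS : D.Sec2Hyps) (h15 : Prop15iii E hC)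
    (h15ii : Prop15ii E.toKummerData hC) (L : C.CuspLabels)
    (hU : ∃ c : contCocycles (MonoidHom.id D.GtpTheta) D.DeltaTheta (D.GtpYdd.map D.toTheta),
      (QuotientGroup.mk c : D.H1Theta (D.GtpYdd.map D.toTheta)) = E.logUdd ∧
      ∀ m : MuN p N, ∃ (g : C.GtpYdduu) (_ : (g : D.PiTemp) ∈ D.DeltaTemp),
        μ.red ⟨((c.1 ⟨D.toTheta g, ⟨g, (Subgroup.mem_inf.1 g.2).1, rfl⟩⟩ ^ l : D.DeltaTheta) : D.GtpTheta),
          coe_pow_mem_lDeltaTheta l _⟩ = m)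
    {η : D.GtpYdd.subgroupOf C.Huu → MuN p N} (hη : η ∈ C.thetaCocycles hC μ) (x : C.Huu)
    (α : ((C.rigidData μ hC hS h15 L).modelBi hη).Iso ((C.rigidData μ hC hS h15 L).modelBi hη))
    (a : (C.rigidData μ hC hS h15 L).PiY ≃ₜ* (C.rigidData μ hC hS h15 L).PiY)
    (hαa : (C.rigidData μ hC hS h15 L).Induces α.e.toMulEquiv a)
    (hax : ∀ y : (C.rigidData μ hC hS h15 L).PiY,
      ((a y : (C.rigidData μ hC hS h15 L).PiY) : C.Huu) = x * (y : C.Huu) * x⁻¹) :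
    (N : ℤ) ∣ 2 * C.zExp x :=
  C.dvd_two_mul_zExp_of_biIso_over_conj μ hC hS h15 h15ii L hU hη x α fun z => by
    have h := congrArg (fun y : (C.rigidData μ hC hS h15 L).PiY => (y : C.Huu)) (hαa z)
    simp only at h
    rw [hax] at h
    exact h

/-- **Prop 2.14 (iii), BI upper bound at the §1 model, under the `N`-free binder** "`log(Ü)` maps `Δ^tp_Ÿ̲̲`
onto `Δ_Θ`" (Prop 1.5 (ii) + Prop 2.2 (ii), see `red_pow_logUdd_surjective_of_logUdd_surjective`): for EVERY
level `N`, every mod-`N` theta cocycle `η`, and every automorphism of `B_N(η)` inducing the translation by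
`x ∈ Π^tp_X̲̲` on `Π^tp_Y̲̲`, `N ∣ 2a` (`a·l` the image of `x` in `Z`), i.e. `N†·l ∣ toZ(x)`.
[cite: MochizukiEtTh2009, Prop 2.14(iii) p.50] -/
theorem ndag_mul_dvd_toZ_of_biIso_over_conj (hC : D.Compat) (hS : D.Sec2Hyps) (h15 : Prop15iii E hC)
    (h15ii : Prop15ii E.toKummerData hC) (L : C.CuspLabels)
    (hUU : ∃ c : contCocycles (MonoidHom.id D.GtpTheta) D.DeltaTheta (D.GtpYdd.map D.toTheta),
      (QuotientGroup.mk c : D.H1Theta (D.GtpYdd.map D.toTheta)) = E.logUdd ∧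
      ∀ z : D.DeltaTheta, ∃ (g : C.GtpYdduu) (_ : (g : D.PiTemp) ∈ D.DeltaTemp),
        c.1 ⟨D.toTheta g, ⟨g, (Subgroup.mem_inf.1 g.2).1, rfl⟩⟩ = z)
    {η : D.GtpYdd.subgroupOf C.Huu → MuN p N} (hη : η ∈ C.thetaCocycles hC μ) (x : C.Huu)
    (α : ((C.rigidData μ hC hS h15 L).modelBi hη).Iso ((C.rigidData μ hC hS h15 L).modelBi hη))
    (hα : ∀ z, ((CycEnvelope.proj (C.rigidData μ hC hS h15 L).augY (C.rigidData μ hC hS h15 L).chi (α.e z) :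
          (C.rigidData μ hC hS h15 L).PiY) : C.Huu) =
        x * ((CycEnvelope.proj (C.rigidData μ hC hS h15 L).augY (C.rigidData μ hC hS h15 L).chi z :
          (C.rigidData μ hC hS h15 L).PiY) : C.Huu) * x⁻¹) :
    (N : ℤ) ∣ 2 * C.zExp x ∧
      (if Odd (N : ℕ) then (N : ℤ) else (N : ℤ) / 2) * l ∣ Multiplicative.toAdd (D.toZ (x : D.PiTemp)) := by
  obtain ⟨c, hcL, hc⟩ := hUU
  have h := C.dvd_two_mul_zExp_of_biIso_over_conj μ hC hS h15 h15ii L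
    ⟨c, hcL, C.red_pow_logUdd_surjective_of_logUdd_surjective μ c hc⟩ hη x α hα
  exact ⟨h, C.ndag_mul_dvd_toZ_of_dvd_two_mul_zExp x h⟩

/-- **The same at every level of a `CyclotomeTower`** (`R = C.rigidData (τ.mod M) hC hS h15 L`), the form
consumed by the model tower `DoubleUnderline.thetaEnvTower`. [cite: MochizukiEtTh2009, Prop 2.14(iii) p.50] -/
theorem dvd_two_mul_zExp_of_biIso_over_conj_tower {Es : Set ℕ+} (τ : D.CyclotomeTower l Es) (M : Es)
    (hC : D.Compat) (hS : D.Sec2Hyps) (h15 : Prop15iii E hC) (h15ii : Prop15ii E.toKummerData hC)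
    (L : C.CuspLabels)
    (hU : ∃ c : contCocycles (MonoidHom.id D.GtpTheta) D.DeltaTheta (D.GtpYdd.map D.toTheta),
      (QuotientGroup.mk c : D.H1Theta (D.GtpYdd.map D.toTheta)) = E.logUdd ∧
      ∀ m : MuN p M, ∃ (g : C.GtpYdduu) (_ : (g : D.PiTemp) ∈ D.DeltaTemp),
        (τ.mod M).red ⟨((c.1 ⟨D.toTheta g, ⟨g, (Subgroup.mem_inf.1 g.2).1, rfl⟩⟩ ^ l : D.DeltaTheta) :
          D.GtpTheta), coe_pow_mem_lDeltaTheta l _⟩ = m)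
    {η : D.GtpYdd.subgroupOf C.Huu → MuN p M} (hη : η ∈ C.thetaCocycles hC (τ.mod M)) (x : C.Huu)
    (α : ((C.rigidData (τ.mod M) hC hS h15 L).modelBi hη).Iso ((C.rigidData (τ.mod M) hC hS h15 L).modelBi hη))
    (hα : ∀ z, ((CycEnvelope.proj (C.rigidData (τ.mod M) hC hS h15 L).augY
          (C.rigidData (τ.mod M) hC hS h15 L).chi (α.e z) : (C.rigidData (τ.mod M) hC hS h15 L).PiY) : C.Huu) =
        x * ((CycEnvelope.proj (C.rigidData (τ.mod M) hC hS h15 L).augY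
          (C.rigidData (τ.mod M) hC hS h15 L).chi z : (C.rigidData (τ.mod M) hC hS h15 L).PiY) : C.Huu) *
          x⁻¹) :
    ((M : ℕ+) : ℤ) ∣ 2 * C.zExp x :=
  C.dvd_two_mul_zExp_of_biIso_over_conj (τ.mod M) hC hS h15 h15ii L hU hη x α hα

end EtaleThetaData.DoubleUnderline

end ThetaSetting

end Literature.AnabelianGeometry.EtaleTheta

end
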